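import Literature.NumberTheory.GaloisRepresentations.AbsGaloisConjByPrime
import Mathlib.RingTheory.IntegralDomain
import Mathlib.FieldTheory.Finite.Basic
import HarnessLib

/-!
# Conjugation of `Γ_K` by a semilinear automorphism `σ̃` of `K̄`: transport of decomposition and inertia
# groups to the prime `σ̃⁻¹𝔓`, and triviality modulo inertia at a prime fixed by `σ̃` (proofs file)

Topic `Literature/NumberTheory/GaloisRepresentations` (sequel to `AbsGaloisConjBy`, `AbsGaloisConjByPrime`).
THEOREMS ONLY: no definition, no named fact, no instance, no `sorry`.

Setting: `K` a field, `K̄ = AlgebraicClosure K`, `γ : K ≃+* K`, `σ̃ : K̄ ≃+* K̄` lifting `γ`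
(`hσa : σ̃ ∘ (K → K̄) = (K → K̄) ∘ γ`), `f = absGalConjBy σ̃ γ hσa : Γ_K →* Γ_K`, `τ ↦ σ̃⁻¹ τ σ̃`
(`AbsGaloisConjBy`), `\bar ℤ_K = absIntegers (𝓞 K) K` the algebraic integers of `K̄` (stable under `σ̃`,
`ringEquiv_apply_mem_absIntegers`), `𝔓` an ideal of `\bar ℤ_K` and `𝔓' = σ̃⁻¹𝔓` the ideal with
`x ∈ 𝔓' ↔ σ̃ x ∈ 𝔓` (hypothesis `h𝔓'`; existence `exists_ideal_forall_mem_iff_apply_mem`).  Neukirch,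
*Algebraic Number Theory*, Ch. I §9, p. 54 (before Prop. (9.1)) and (9.4)–(9.6): for an automorphism `σ`,
«`G_{σ𝔓} = σ G_𝔓 σ⁻¹`, `I_{σ𝔓} = σ I_𝔓 σ⁻¹`» — here for the SEMILINEAR `σ̃` (not in `Γ_K`), read through
`f`:

* §1 `exists_ideal_forall_mem_iff_apply_mem` (the ideal `σ̃⁻¹𝔓`, maximal with `𝔓`);
  **`absGalConjBy_mem_decompositionSubgroup_of_mem`** — `τ ∈ D_𝔓 → f τ ∈ D_{σ̃⁻¹𝔓}`, with the `iff` and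
  `map f D_𝔓 = D_{σ̃⁻¹𝔓}` (`map_absGalConjBy_decompositionSubgroup_eq`);
  **`absGalConjBy_mem_inertia_of_mem`** — `τ ∈ I_𝔓 → f τ ∈ I_{σ̃⁻¹𝔓}`, `iff`, `map f I_𝔓 = I_{σ̃⁻¹𝔓}`.
* §2 (a field all of whose elements satisfy `x ^ q = x` for some `q > 1`, e.g. an algebraic extension of a
  finite field): `exists_zpow_eq_of_ringHom` (every ring endomorphism is a power map on the solutions of
  `y ^ q = y`: they form a finite cyclic subgroup of the units) and **`ringHom_apply_comm_of_forall_pow_eq`**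
  — any two ring endomorphisms of such a field COMMUTE (Lidl–Niederreiter Thm. 2.21: the automorphisms of
  `𝔽_{q^m}` are the powers of Frobenius; here in the elementary cyclic-group form valid for infinite algebraic
  extensions).
* §3 **`absGalConjBy_mul_inv_mem_inertia`**, **`inv_mul_absGalConjBy_mem_inertia`** — if `σ̃` FIXES `𝔓`
  (`x ∈ 𝔓 ↔ σ̃ x ∈ 𝔓`) and every element of the residue field `\bar ℤ_K ⧸ 𝔓` satisfies `x ^ q = x` for some
  `q > 1`, then for every `τ ∈ D_𝔓`: `(σ̃⁻¹τσ̃) τ⁻¹ ∈ I_𝔓` and `τ⁻¹ (σ̃⁻¹τσ̃) ∈ I_𝔓` — conjugation by `σ̃` is the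
  IDENTITY on `D_𝔓 / I_𝔓` (the induced automorphisms `τ̄`, `σ̄` of the residue field commute by §2).

Consumer: `Howard2004/ConjugationDatumInertiaProofs` (the inertia letters `hI`, `hφI`, `hφγ` of a conjugation
datum at a degree-two prime, cell `pub/bsd-print-x9`, G87).  Classical algebraic number theory; nothing here
is specific to elliptic curves; BSD is not proved by any of this.

References: [NeukirchANT1999] Ch. I §9 (pp. 54–58: `σ𝒪 = 𝒪`, (9.4)–(9.6), `G_{σ𝔓} = σG_𝔓σ⁻¹`);
[LidlNiederreiter1997] Thm. 2.21 (automorphisms of finite fields), Thm. 2.8 (`x^q = x`);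
[SerreLocalFields1979] Ch. I §7 Prop. 20–22 (inertia, residue extensions).
-/

set_option autoImplicit false

noncomputable section

open scoped Pointwise NumberField
open NumberField Field Polynomial
open Literature.NumberTheory.NumberFields

namespace Literature.NumberTheory.GaloisRepresentations

/-! ## §1 Transport of `D_𝔓` and `I_𝔓` under conjugation by `σ̃` -/

section Transport

variable {K : Type} [Field K] (σt : AlgebraicClosure K ≃+* AlgebraicClosure K) (γ : K ≃+* K)
  (hσa : ∀ a : K, σt (algebraMap K (AlgebraicClosure K) a) = algebraMap K (AlgebraicClosure K) (γ a))

/-- **The ideal `σ̃⁻¹𝔓`**: for every ideal `𝔓` of `\bar ℤ_K` there is an ideal `𝔓'` with `x ∈ 𝔓' ↔ σ̃ x ∈ 𝔓`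
(the pull-back of `𝔓` along the ring automorphism of `\bar ℤ_K` induced by `σ̃`,
`exists_ringEquiv_absIntegers_coe_eq`); it is maximal when `𝔓` is.
[cite: NeukirchANT1999, Ch. I §9 (p. 54: σ𝒪 = 𝒪, σ𝔓 is again a prime above σ𝔭)] -/
theorem exists_ideal_forall_mem_iff_apply_mem (𝔓 : Ideal (absIntegers (𝓞 K) K)) :
    ∃ 𝔓' : Ideal (absIntegers (𝓞 K) K), (𝔓.IsMaximal → 𝔓'.IsMaximal) ∧
      ∀ x : absIntegers (𝓞 K) K,
        x ∈ 𝔓' ↔ (⟨σt x, ringEquiv_apply_mem_absIntegers σt x.2⟩ : absIntegers (𝓞 K) K) ∈ 𝔓 := by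
  obtain ⟨g, hg, -⟩ := exists_ringEquiv_absIntegers_coe_eq (L := K) σt
  have hgx : ∀ y : absIntegers (𝓞 K) K, g y = ⟨σt y, ringEquiv_apply_mem_absIntegers σt y.2⟩ :=
    fun y => Subtype.ext (hg y)
  refine ⟨𝔓.comap (g : absIntegers (𝓞 K) K →+* absIntegers (𝓞 K) K), fun hmax => ?_, fun x => ?_⟩
  · exact Ideal.comap_isMaximal_of_surjective _ g.surjective
  · rw [Ideal.mem_comap, RingHom.coe_coe, hgx]

variable {𝔓 𝔓' : Ideal (absIntegers (𝓞 K) K)}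
  (h𝔓' : ∀ x : absIntegers (𝓞 K) K,
    x ∈ 𝔓' ↔ (⟨σt x, ringEquiv_apply_mem_absIntegers σt x.2⟩ : absIntegers (𝓞 K) K) ∈ 𝔓)

include h𝔓'

/-- Reading `h𝔓'` backwards: `x ∈ 𝔓 ↔ σ̃⁻¹ x ∈ 𝔓'`. [cite: NeukirchANT1999, Ch. I §9 (p. 54)] -/
theorem mem_iff_symm_apply_mem (x : absIntegers (𝓞 K) K) :
    x ∈ 𝔓 ↔ (⟨σt.symm x, ringEquiv_apply_mem_absIntegers σt.symm x.2⟩ : absIntegers (𝓞 K) K) ∈ 𝔓' := by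
  rw [h𝔓']
  have hx : (⟨σt ((⟨σt.symm x, ringEquiv_apply_mem_absIntegers σt.symm x.2⟩ : absIntegers (𝓞 K) K) :
      AlgebraicClosure K), ringEquiv_apply_mem_absIntegers σt
        (⟨σt.symm x, ringEquiv_apply_mem_absIntegers σt.symm x.2⟩ : absIntegers (𝓞 K) K).2⟩ :
      absIntegers (𝓞 K) K) = x := Subtype.ext (by simp)
  rw [hx]

/-- For `τ ∈ D_𝔓` and every algebraic integer `x`: `(σ̃⁻¹τσ̃) x ∈ 𝔓' ↔ x ∈ 𝔓'` (`σ̃` of the left side is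
`τ (σ̃ x)`, and `τ` stabilises `𝔓`). [cite: NeukirchANT1999, Ch. I §9 (p. 54: G_{σ𝔓} = σ G_𝔓 σ⁻¹)] -/
theorem absGalConjBy_smul_mem_iff_of_mem {τ : absoluteGaloisGroup K}
    (hτ : τ ∈ 𝔓.decompositionSubgroup (absoluteGaloisGroup K)) (x : absIntegers (𝓞 K) K) :
    absGalConjBy σt γ hσa τ • x ∈ 𝔓' ↔ x ∈ 𝔓' := by
  rw [h𝔓', h𝔓']
  have key : (⟨σt ((absGalConjBy σt γ hσa τ • x : absIntegers (𝓞 K) K) : AlgebraicClosure K),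
      ringEquiv_apply_mem_absIntegers σt (absGalConjBy σt γ hσa τ • x).2⟩ : absIntegers (𝓞 K) K) =
      τ • (⟨σt x, ringEquiv_apply_mem_absIntegers σt x.2⟩ : absIntegers (𝓞 K) K) := by
    apply Subtype.ext
    change σt (((absGalConjBy σt γ hσa τ • x : absIntegers (𝓞 K) K)) : AlgebraicClosure K) =
      ((τ • (⟨σt x, ringEquiv_apply_mem_absIntegers σt x.2⟩ : absIntegers (𝓞 K) K) :
        absIntegers (𝓞 K) K) : AlgebraicClosure K)
    rw [coe_absGalConjBy_smul_absIntegers, RingEquiv.apply_symm_apply, integralClosure.coe_smul]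
  rw [key]
  have hτ' : τ • 𝔓 = 𝔓 := hτ
  constructor
  · intro h
    have h2 : τ • (⟨σt x, ringEquiv_apply_mem_absIntegers σt x.2⟩ : absIntegers (𝓞 K) K) ∈ τ • 𝔓 := by
      rwa [hτ']
    exact Ideal.smul_mem_pointwise_smul_iff.mp h2
  · intro h
    rw [← hτ']
    exact Ideal.smul_mem_pointwise_smul _ _ _ h

/-- **`τ ∈ D_𝔓 ⇒ σ̃⁻¹τσ̃ ∈ D_{σ̃⁻¹𝔓}`** (Neukirch: `G_{σ𝔓} = σG_𝔓σ⁻¹`, for the semilinear `σ̃`).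
[cite: NeukirchANT1999, Ch. I §9 (p. 54: G_{σ𝔓} = σ G_𝔓 σ⁻¹)] -/
theorem absGalConjBy_mem_decompositionSubgroup_of_mem {τ : absoluteGaloisGroup K}
    (hτ : τ ∈ 𝔓.decompositionSubgroup (absoluteGaloisGroup K)) :
    absGalConjBy σt γ hσa τ ∈ 𝔓'.decompositionSubgroup (absoluteGaloisGroup K) := by
  rw [Ideal.mem_decompositionSubgroup_iff]
  ext x
  rw [Ideal.mem_pointwise_smul_iff_inv_smul_mem, ← map_inv]
  exact absGalConjBy_smul_mem_iff_of_mem σt γ hσa h𝔓' (inv_mem hτ) x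

/-- **`τ ∈ I_𝔓 ⇒ σ̃⁻¹τσ̃ ∈ I_{σ̃⁻¹𝔓}`**: `(σ̃⁻¹τσ̃) x - x = σ̃⁻¹ (τ (σ̃ x) - σ̃ x)` and `τ (σ̃ x) - σ̃ x ∈ 𝔓`.
[cite: NeukirchANT1999, Ch. I §9 (p. 54 and (9.6): I_{σ𝔓} = σ I_𝔓 σ⁻¹)] -/
theorem absGalConjBy_mem_inertia_of_mem {τ : absoluteGaloisGroup K}
    (hτ : τ ∈ 𝔓.inertia (absoluteGaloisGroup K)) :
    absGalConjBy σt γ hσa τ ∈ 𝔓'.inertia (absoluteGaloisGroup K) := by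
  intro x
  rw [Submodule.mem_toAddSubgroup, h𝔓']
  set y : absIntegers (𝓞 K) K := ⟨σt x, ringEquiv_apply_mem_absIntegers σt x.2⟩ with hy_def
  have hy : τ • y - y ∈ 𝔓 := hτ y
  have key : (⟨σt ((absGalConjBy σt γ hσa τ • x - x : absIntegers (𝓞 K) K) : AlgebraicClosure K),
      ringEquiv_apply_mem_absIntegers σt (absGalConjBy σt γ hσa τ • x - x).2⟩ : absIntegers (𝓞 K) K) =
      τ • y - y := by
    apply Subtype.ext
    simp only [hy_def, Subalgebra.coe_sub, integralClosure.coe_smul, map_sub, absGalConjBy_smul,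
      RingEquiv.apply_symm_apply]
  rw [key]
  exact hy

/-- Conversely **`σ̃⁻¹τσ̃ ∈ I_{σ̃⁻¹𝔓} ⇒ τ ∈ I_𝔓`** (read the previous identity at `σ̃⁻¹ x`).
[cite: NeukirchANT1999, Ch. I §9 (p. 54 and (9.6))] -/
theorem mem_inertia_of_absGalConjBy_mem {τ : absoluteGaloisGroup K}
    (hτ : absGalConjBy σt γ hσa τ ∈ 𝔓'.inertia (absoluteGaloisGroup K)) :
    τ ∈ 𝔓.inertia (absoluteGaloisGroup K) := by
  intro x
  rw [Submodule.mem_toAddSubgroup]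
  set z : absIntegers (𝓞 K) K := ⟨σt.symm x, ringEquiv_apply_mem_absIntegers σt.symm x.2⟩ with hz_def
  have hz : absGalConjBy σt γ hσa τ • z - z ∈ 𝔓' := hτ z
  rw [h𝔓'] at hz
  have key : (⟨σt ((absGalConjBy σt γ hσa τ • z - z : absIntegers (𝓞 K) K) : AlgebraicClosure K),
      ringEquiv_apply_mem_absIntegers σt (absGalConjBy σt γ hσa τ • z - z).2⟩ : absIntegers (𝓞 K) K) =
      τ • x - x := by
    apply Subtype.ext
    simp only [hz_def, Subalgebra.coe_sub, integralClosure.coe_smul, map_sub, absGalConjBy_smul,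
      RingEquiv.apply_symm_apply]
  rwa [key] at hz

/-- `σ̃⁻¹τσ̃ ∈ I_{σ̃⁻¹𝔓} ↔ τ ∈ I_𝔓`. [cite: NeukirchANT1999, Ch. I §9 (9.6)] -/
theorem absGalConjBy_mem_inertia_iff (τ : absoluteGaloisGroup K) :
    absGalConjBy σt γ hσa τ ∈ 𝔓'.inertia (absoluteGaloisGroup K) ↔ τ ∈ 𝔓.inertia (absoluteGaloisGroup K) :=
  ⟨mem_inertia_of_absGalConjBy_mem σt γ hσa h𝔓', absGalConjBy_mem_inertia_of_mem σt γ hσa h𝔓'⟩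

/-- **`I_{σ̃⁻¹𝔓} = σ̃⁻¹ I_𝔓 σ̃`** as subgroups of `Γ_K`: the image of `I_𝔓` under `f = absGalConjBy σ̃ γ hσa` is
`I_{σ̃⁻¹𝔓}` (`f` is a bijection of `Γ_K`, `absGalConjBy_bijective`). [cite: NeukirchANT1999, Ch. I §9 (9.6) (I_{σ𝔓} = σ I_𝔓 σ⁻¹)] -/
theorem map_absGalConjBy_inertia_eq :
    (𝔓.inertia (absoluteGaloisGroup K)).map (absGalConjBy σt γ hσa) = 𝔓'.inertia (absoluteGaloisGroup K) := by
  ext t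
  constructor
  · rintro ⟨τ, hτ, rfl⟩
    exact absGalConjBy_mem_inertia_of_mem σt γ hσa h𝔓' hτ
  · intro ht
    obtain ⟨τ, rfl⟩ := (absGalConjBy_bijective σt γ hσa).2 t
    exact ⟨τ, mem_inertia_of_absGalConjBy_mem σt γ hσa h𝔓' ht, rfl⟩

/-- `σ̃⁻¹ D_𝔓 σ̃ ≤ D_{σ̃⁻¹𝔓}`: the image of `D_𝔓` under `f` lies in `D_{σ̃⁻¹𝔓}`.
[cite: NeukirchANT1999, Ch. I §9 (p. 54: G_{σ𝔓} = σ G_𝔓 σ⁻¹)] -/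
theorem map_absGalConjBy_decompositionSubgroup_le :
    (𝔓.decompositionSubgroup (absoluteGaloisGroup K)).map (absGalConjBy σt γ hσa) ≤
      𝔓'.decompositionSubgroup (absoluteGaloisGroup K) := by
  rintro _ ⟨τ, hτ, rfl⟩
  exact absGalConjBy_mem_decompositionSubgroup_of_mem σt γ hσa h𝔓' hτ

end Transport

/-! ## §2 Ring endomorphisms of a field of «finite-field type» commute -/

section FiniteType

/-- On the non-zero solutions of `y ^ q = y` (`q > 1`) in a field, every ring endomorphism is a power map
`y ↦ y ^ k` (`k ∈ ℤ`): these solutions form a finite (roots of `X ^ q - X`), hence cyclic, subgroup of the units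
(Mathlib `isCyclic_subgroup_units`), stable under the endomorphism, and the image of a generator is a power of it.
[cite: LidlNiederreiter1997, Thm. 2.8 and Thm. 2.21 (the elements of `𝔽_q` are the roots of `x^q − x`; automorphisms are power maps)] -/
theorem exists_zpow_eq_of_ringHom {F : Type*} [Field F] {q : ℕ} (hq : 1 < q) (b : F →+* F) :
    ∃ k : ℤ, ∀ y : F, y ≠ 0 → y ^ q = y → b y = y ^ k := by
  classical
  -- the subgroup `U = {u : Fˣ | u ^ q = u}` of `Fˣ`
  let U : Subgroup Fˣ :=
    { carrier := {u | (u : F) ^ q = u}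
      mul_mem' := by
        intro u v hu hv
        simp only [Set.mem_setOf_eq, Units.val_mul] at hu hv ⊢
        rw [mul_pow, hu, hv]
      one_mem' := by simp
      inv_mem' := by
        intro u hu
        simp only [Set.mem_setOf_eq, Units.val_inv_eq_inv_val] at hu ⊢
        rw [inv_pow, hu] }
  have hUmem : ∀ u : Fˣ, u ∈ U ↔ (u : F) ^ q = u := fun u => Iff.rfl
  -- `U` is finite: it injects into the root set of `X ^ q - X`
  have hne : (X ^ q - X : F[X]) ≠ 0 := FiniteField.X_pow_card_sub_X_ne_zero F hq
  have hsub : ∀ y : F, y ^ q = y → y ∈ (X ^ q - X : F[X]).rootSet F := by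
    intro y hy
    rw [mem_rootSet]
    refine ⟨hne, ?_⟩
    simp [hy]
  haveI : Finite U := by
    have hfin : Set.Finite {y : F | y ^ q = y} :=
      (rootSet_finite (X ^ q - X : F[X]) F).subset fun y hy => hsub y hy
    have hinj : Function.Injective
        fun u : U => (⟨((u : Fˣ) : F), (hUmem u).mp u.2⟩ : {y : F | y ^ q = y}) := by
      intro u₁ u₂ h
      have h' := congrArg Subtype.val h
      exact Subtype.ext (Units.ext h')
    haveI : Finite {y : F | y ^ q = y} := hfin
    exact Finite.of_injective _ hinj
  obtain ⟨ζ, hζ⟩ := IsCyclic.exists_generator (α := U)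
  -- `b ζ` is again a non-zero solution, hence a power of `ζ`
  have hbζq : (b (ζ : Fˣ)) ^ q = b (ζ : Fˣ) := by rw [← map_pow, (hUmem _).mp ζ.2]
  have hbζ0 : b ((ζ : Fˣ) : F) ≠ 0 := by
    rw [_root_.map_ne_zero]
    exact (ζ : Fˣ).ne_zero
  obtain ⟨k, hk⟩ :=
    Subgroup.mem_zpowers_iff.mp (hζ ⟨Units.mk0 _ hbζ0, (hUmem _).mpr (by simpa using hbζq)⟩)
  have hbζ : b ((ζ : Fˣ) : F) = ((ζ : Fˣ) : F) ^ k := by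
    have := congrArg (fun w : U => (((w : Fˣ)) : F)) hk
    simpa using this.symm
  refine ⟨k, fun y hy0 hy => ?_⟩
  set u : Fˣ := Units.mk0 y hy0 with hu
  have huU : u ∈ U := (hUmem u).mpr (by simpa [hu] using hy)
  obtain ⟨n, hn⟩ := Subgroup.mem_zpowers_iff.mp (hζ ⟨u, huU⟩)
  have hy' : y = ((ζ : Fˣ) : F) ^ n := by
    have := congrArg (fun w : U => (((w : Fˣ)) : F)) hn
    simpa [hu] using this.symm
  rw [hy', map_zpow₀, hbζ, ← zpow_mul, ← zpow_mul, mul_comm]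

/-- **Ring endomorphisms of a field of finite-field type commute**: if every element of the field `F` satisfies
`x ^ q = x` for some `q > 1` (e.g. `F` algebraic over a finite field — an algebraic closure of `𝔽_p`, the residue
field of `\bar ℤ_K` at a maximal ideal), then `a (b x) = b (a x)` for any two ring endomorphisms `a`, `b` of `F`
(both are power maps on the finite field through `x`). [cite: LidlNiederreiter1997, Thm. 2.21 (the automorphisms of `𝔽_{q^m}` over `𝔽_q` are exactly the powers of Frobenius; hence `Aut(𝔽̄_p)` is abelian)] -/
theorem ringHom_apply_comm_of_forall_pow_eq {F : Type*} [Field F]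
    (hF : ∀ x : F, ∃ q : ℕ, 1 < q ∧ x ^ q = x) (a b : F →+* F) (x : F) : a (b x) = b (a x) := by
  by_cases hx0 : x = 0
  · subst hx0
    simp
  obtain ⟨q, hq, hx⟩ := hF x
  obtain ⟨k, hk⟩ := exists_zpow_eq_of_ringHom hq b
  have hax0 : a x ≠ 0 := by rwa [_root_.map_ne_zero]
  have hax : (a x) ^ q = a x := by rw [← map_pow, hx]
  rw [hk x hx0 hx, map_zpow₀, hk (a x) hax0 hax]

end FiniteType

/-! ## §3 At a prime FIXED by `σ̃`: conjugation by `σ̃` is the identity on `D_𝔓 / I_𝔓` -/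

section Fixed

variable {K : Type} [Field K] (σt : AlgebraicClosure K ≃+* AlgebraicClosure K) (γ : K ≃+* K)
  (hσa : ∀ a : K, σt (algebraMap K (AlgebraicClosure K) a) = algebraMap K (AlgebraicClosure K) (γ a))
  {𝔓 : Ideal (absIntegers (𝓞 K) K)}
  (h𝔓 : ∀ x : absIntegers (𝓞 K) K,
    x ∈ 𝔓 ↔ (⟨σt x, ringEquiv_apply_mem_absIntegers σt x.2⟩ : absIntegers (𝓞 K) K) ∈ 𝔓)
  (hκ : ∀ x : absIntegers (𝓞 K) K ⧸ 𝔓, ∃ q : ℕ, 1 < q ∧ x ^ q = x)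

include h𝔓 hκ

/-- **The key congruence**: if `σ̃` fixes the maximal ideal `𝔓` and the residue field `κ(𝔓)` is of
finite-field type, then for `τ ∈ D_𝔓` and every algebraic integer `x`: `(σ̃⁻¹τσ̃) x ≡ τ x (mod 𝔓)` — the
automorphisms of `κ(𝔓)` induced by `τ` and by `σ̃` commute (§2), and `σ̃ 𝔓 = 𝔓`.
[cite: NeukirchANT1999, Ch. I §9 Prop. (9.4) (D_𝔓 → Aut κ(𝔓)) with (9.6)] [cite: LidlNiederreiter1997, Thm. 2.21] -/
theorem absGalConjBy_smul_sub_smul_mem [𝔓.IsMaximal] {τ : absoluteGaloisGroup K}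
    (hτ : τ ∈ 𝔓.decompositionSubgroup (absoluteGaloisGroup K)) (x : absIntegers (𝓞 K) K) :
    absGalConjBy σt γ hσa τ • x - τ • x ∈ 𝔓 := by
  classical
  letI : Field (absIntegers (𝓞 K) K ⧸ 𝔓) := Ideal.Quotient.field 𝔓
  -- the ring automorphism `g` of `\bar ℤ_K` induced by `σ̃`, and the two induced endomorphisms of `κ(𝔓)`
  obtain ⟨g, hg, hgs⟩ := exists_ringEquiv_absIntegers_coe_eq (L := K) σt
  have hgx : ∀ y : absIntegers (𝓞 K) K, g y = ⟨σt y, ringEquiv_apply_mem_absIntegers σt y.2⟩ :=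
    fun y => Subtype.ext (hg y)
  have hτ𝔓 : τ • 𝔓 = 𝔓 := hτ
  have hle_g : 𝔓 ≤ 𝔓.comap (g : absIntegers (𝓞 K) K →+* absIntegers (𝓞 K) K) := by
    intro y hy
    rw [Ideal.mem_comap, RingHom.coe_coe, hgx]
    exact (h𝔓 y).mp hy
  have hle_τ : 𝔓 ≤ 𝔓.comap (MulSemiringAction.toRingHom (absoluteGaloisGroup K) (absIntegers (𝓞 K) K) τ) := by
    intro y hy
    rw [Ideal.mem_comap, MulSemiringAction.toRingHom_apply, ← hτ𝔓]
    exact Ideal.smul_mem_pointwise_smul _ _ _ hy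
  let bκ : absIntegers (𝓞 K) K ⧸ 𝔓 →+* absIntegers (𝓞 K) K ⧸ 𝔓 :=
    Ideal.quotientMap 𝔓 (g : absIntegers (𝓞 K) K →+* absIntegers (𝓞 K) K) hle_g
  let aκ : absIntegers (𝓞 K) K ⧸ 𝔓 →+* absIntegers (𝓞 K) K ⧸ 𝔓 :=
    Ideal.quotientMap 𝔓 (MulSemiringAction.toRingHom (absoluteGaloisGroup K) (absIntegers (𝓞 K) K) τ) hle_τ
  -- commutation in `κ(𝔓)`: `τ (σ̃ x) ≡ σ̃ (τ x) (mod 𝔓)`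
  have hcomm : aκ (bκ (Ideal.Quotient.mk 𝔓 x)) = bκ (aκ (Ideal.Quotient.mk 𝔓 x)) :=
    ringHom_apply_comm_of_forall_pow_eq hκ aκ bκ _
  simp only [aκ, bκ, Ideal.quotientMap_mk, RingHom.coe_coe, MulSemiringAction.toRingHom_apply,
    Ideal.Quotient.mk_eq_mk_iff_sub_mem] at hcomm
  -- `hcomm : τ • g x - g (τ • x) ∈ 𝔓`; apply `σ̃⁻¹`, i.e. read through `h𝔓`
  rw [h𝔓]
  have key : (⟨σt ((absGalConjBy σt γ hσa τ • x - τ • x : absIntegers (𝓞 K) K) : AlgebraicClosure K),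
      ringEquiv_apply_mem_absIntegers σt (absGalConjBy σt γ hσa τ • x - τ • x).2⟩ : absIntegers (𝓞 K) K) =
      τ • g x - g (τ • x) := by
    apply Subtype.ext
    simp only [Subalgebra.coe_sub, integralClosure.coe_smul, map_sub, absGalConjBy_smul,
      RingEquiv.apply_symm_apply, hg]
  rw [key]
  exact hcomm

/-- **`(σ̃⁻¹τσ̃) τ⁻¹ ∈ I_𝔓` for `τ ∈ D_𝔓`** when `σ̃` fixes `𝔓` (residue field of finite-field type): conjugation by
`σ̃` is the identity on `D_𝔓` modulo the inertia group. [cite: NeukirchANT1999, Ch. I §9 Prop. (9.4)–(9.6)] [cite: LidlNiederreiter1997, Thm. 2.21] -/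
theorem absGalConjBy_mul_inv_mem_inertia [𝔓.IsMaximal] {τ : absoluteGaloisGroup K}
    (hτ : τ ∈ 𝔓.decompositionSubgroup (absoluteGaloisGroup K)) :
    absGalConjBy σt γ hσa τ * τ⁻¹ ∈ 𝔓.inertia (absoluteGaloisGroup K) := by
  intro y
  rw [Submodule.mem_toAddSubgroup, mul_smul]
  have h := absGalConjBy_smul_sub_smul_mem σt γ hσa h𝔓 hκ hτ (τ⁻¹ • y)
  rwa [smul_inv_smul] at h

/-- **`τ⁻¹ (σ̃⁻¹τσ̃) ∈ I_𝔓` for `τ ∈ D_𝔓`** when `σ̃` fixes `𝔓` (the other order; apply `τ⁻¹ ∈ D_𝔓` to the key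
congruence). [cite: NeukirchANT1999, Ch. I §9 Prop. (9.4)–(9.6)] [cite: LidlNiederreiter1997, Thm. 2.21] -/
theorem inv_mul_absGalConjBy_mem_inertia [𝔓.IsMaximal] {τ : absoluteGaloisGroup K}
    (hτ : τ ∈ 𝔓.decompositionSubgroup (absoluteGaloisGroup K)) :
    τ⁻¹ * absGalConjBy σt γ hσa τ ∈ 𝔓.inertia (absoluteGaloisGroup K) := by
  intro y
  rw [Submodule.mem_toAddSubgroup, mul_smul]
  have h := absGalConjBy_smul_sub_smul_mem σt γ hσa h𝔓 hκ hτ y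
  have hτ' : τ⁻¹ • 𝔓 = 𝔓 := inv_mem hτ
  have h2 : τ⁻¹ • (absGalConjBy σt γ hσa τ • y - τ • y) ∈ τ⁻¹ • 𝔓 :=
    Ideal.smul_mem_pointwise_smul _ _ _ h
  rwa [hτ', smul_sub, inv_smul_smul] at h2

end Fixed

/-! ## §4 Number fields: the residue fields of `\bar ℤ_K` are of finite-field type -/

section NumberField

variable {K : Type} [Field K] [NumberField K]

/-- **Every element of `κ(𝔓) = \bar ℤ_K ⧸ 𝔓` satisfies `x ^ q = x` for some `q > 1`** (`𝔓` a prime of `\bar ℤ_K`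
above a finite place `v` of the number field `K`): `κ(𝔓)` is algebraic over the finite field `𝓞 K ⧸ v`
(`Ideal.Quotient.algebra_isIntegral_of_liesOver`), so `x` lies in the finite field `(𝓞 K ⧸ v)(x)`, where
`y ^ #((𝓞 K ⧸ v)(x)) = y`. [cite: LidlNiederreiter1997, Lemma 2.3 and Thm. 2.8 (a^q = a in a field with q elements)] [cite: NeukirchANT1999, Ch. I §9 (residue fields of the primes above 𝔭 are algebraic over κ(𝔭))] -/
theorem absIntegers.exists_one_lt_pow_eq_self_of_mem_primesAbove {v : IsDedekindDomain.HeightOneSpectrum (𝓞 K)}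
    {𝔓 : Ideal (absIntegers (𝓞 K) K)} (h𝔓 : 𝔓 ∈ v.primesAbove) (x : absIntegers (𝓞 K) K ⧸ 𝔓) :
    ∃ q : ℕ, 1 < q ∧ x ^ q = x := by
  classical
  haveI := h𝔓.1
  haveI := h𝔓.2
  haveI : 𝔓.IsMaximal := IsDedekindDomain.HeightOneSpectrum.isMaximal_of_mem_primesAbove h𝔓
  letI : Field (absIntegers (𝓞 K) K ⧸ 𝔓) := Ideal.Quotient.field 𝔓
  haveI : v.asIdeal.IsMaximal := v.isMaximal
  letI : Field (𝓞 K ⧸ v.asIdeal) := Ideal.Quotient.field v.asIdeal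
  haveI : Finite (𝓞 K ⧸ v.asIdeal) := Ideal.finiteQuotientOfFreeOfNeBot v.asIdeal v.ne_bot
  haveI : Fintype (𝓞 K ⧸ v.asIdeal) := Fintype.ofFinite _
  -- `κ(𝔓)` is algebraic over the finite field `k_v = 𝓞 K ⧸ v`
  haveI : Algebra.IsIntegral (𝓞 K ⧸ v.asIdeal) (absIntegers (𝓞 K) K ⧸ 𝔓) :=
    Ideal.Quotient.algebra_isIntegral_of_liesOver (A := 𝓞 K) (p := v.asIdeal) (P := 𝔓)
  haveI : Algebra.IsAlgebraic (𝓞 K ⧸ v.asIdeal) (absIntegers (𝓞 K) K ⧸ 𝔓) := Algebra.IsIntegral.isAlgebraic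
  have hx : IsIntegral (𝓞 K ⧸ v.asIdeal) x := (Algebra.IsAlgebraic.isAlgebraic x).isIntegral
  -- the finite field `k_v(x)`
  set L := IntermediateField.adjoin (𝓞 K ⧸ v.asIdeal) ({x} : Set (absIntegers (𝓞 K) K ⧸ 𝔓)) with hL
  haveI : FiniteDimensional (𝓞 K ⧸ v.asIdeal) L := IntermediateField.adjoin.finiteDimensional hx
  haveI : Finite L := Module.finite_of_finite (𝓞 K ⧸ v.asIdeal)
  haveI : Fintype L := Fintype.ofFinite L
  refine ⟨Fintype.card L, Fintype.one_lt_card, ?_⟩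
  have hxL : x ∈ L := IntermediateField.mem_adjoin_simple_self _ x
  have h := FiniteField.pow_card (⟨x, hxL⟩ : L)
  have h' := congrArg (fun z : L => (z : absIntegers (𝓞 K) K ⧸ 𝔓)) h
  simpa using h'

end NumberField

end Literature.NumberTheory.GaloisRepresentations

end
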